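import Mathlib
import HarnessLib
import Literature.Computability.AlgebraicComplexity.HessianRank

/-!
# Crux `RankDefectRepresentations` (stmt-PneNP-18923), line `rank-dehn-ladder`, stub `stub_cutLemma`: CHARACTER CUTS ARE CHEAP

Setting of the registered negative rung `stub_cutLemma` (the general cut lemma of `Lines/dead-RDR-analysis-v2.md`):
rows `x : ι` and columns `y : ι'` carry cube colours `row x, col y : Fin n → Bool`, and the `j`-th COORDINATE CUT of a matrix
`R` is `R ∘ 1[row_j ≠ col_j]` (the part of `R` on colour pairs differing at `j`), of rank `t_j`.

This file proves the first structural rung of the lead's analysis (`Lines/rank-dehn-ladder-briefs.md` §Lead (3)): for EVERY set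
`T` of coordinates, the CHARACTER CUT `R ∘ 1[#{j ∈ T : row_j ≠ col_j} odd]` — the part of `R` on colour pairs separated by the
character `χ_T` — has rank at most `∑_{j ∈ T} t_j` (`rank_characterCut_le`).  So all `2^n` character bipartitions of the colour cube are
as cheap as the `n` coordinate ones, uniformly in the field (no characteristic assumption): a superpolynomial gap in the cut lemma,
if it exists, is invisible to every character rectangle (`rank_submatrix_characterSeparated_le`: a rectangle `S × S'` whose row
colours have `χ_T`-parity `a` and column colours parity `≠ a` has rank `≤ ∑_{j∈T} t_j`; e.g. even-weight rows against odd-weight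
columns cost at most `∑_j t_j`).

Proof: exact identity `M_{T ∪ {j}} = M_T + D_T · X_j · D'_T` with `D_T, D'_T` the diagonal sign matrices `∏_{l∈T} (−1)^{row_l}`,
`∏_{l ∈ T}(−1)^{col_l}` (entrywise: `(−1)^{#differ on T} = sign(row) · sign(col)`), then `rank (D X D') ≤ rank X` and induction on `T`.
HONEST FRAMING: a tool lemma on the Negative/ lane of the crux; P ≠ NP is not moved; F-N2 is a FRONTIER formal rung.
-/

set_option linter.dupNamespace false -- `Summit.PneNP.PneNP.…`: summit = sub-problem name (D-0017)

namespace Summit.PneNP.PneNP.Theorems.CnfIdealGenLengthRankDefectRepresentationsCutLemmaCharacterCuts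

open Finset Matrix

variable {K : Type*} [Field K] {n : ℕ} {ι ι' : Type*} [Fintype ι] [Fintype ι'] [DecidableEq ι] [DecidableEq ι']

/-- The sign identity behind the telescoping: for Booleans `r_l, c_l` (`l ∈ T`),
`∏_{l∈T} s(r_l) · ∏_{l∈T} s(c_l) = (−1)^{#{l ∈ T : r_l ≠ c_l}}` where `s(true) = −1`, `s(false) = 1`. [folklore] -/
theorem prod_sign_mul_prod_sign (T : Finset (Fin n)) (r c : Fin n → Bool) :
    (∏ l ∈ T, (if r l then (-1 : K) else 1)) * (∏ l ∈ T, (if c l then (-1 : K) else 1)) =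
      (-1) ^ (T.filter fun l => r l ≠ c l).card := by
  classical
  induction T using Finset.induction_on with
  | empty => simp
  | insert j T hj ih =>
    rw [Finset.prod_insert hj, Finset.prod_insert hj, Finset.filter_insert]
    have key : ((if r j then (-1 : K) else 1) * if c j then (-1 : K) else 1) =
        if r j ≠ c j then -1 else 1 := by
      cases r j <;> cases c j <;> simp
    calc (if r j then (-1 : K) else 1) * (∏ l ∈ T, if r l then (-1 : K) else 1) *
          ((if c j then (-1 : K) else 1) * ∏ l ∈ T, if c l then (-1 : K) else 1)
        = (((if r j then (-1 : K) else 1) * if c j then (-1 : K) else 1)) *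
            ((∏ l ∈ T, if r l then (-1 : K) else 1) * ∏ l ∈ T, if c l then (-1 : K) else 1) := by ring
      _ = (if r j ≠ c j then -1 else 1) * (-1) ^ (T.filter fun l => r l ≠ c l).card := by rw [key, ih]
      _ = (-1) ^ (if r j ≠ c j then insert j (T.filter fun l => r l ≠ c l)
            else T.filter fun l => r l ≠ c l).card := by
          by_cases h : r j ≠ c j
          · rw [if_pos h, if_pos h, Finset.card_insert_of_notMem (by simp [hj]), pow_succ]; ring
          · rw [if_neg h, if_neg h, one_mul]

/-- One telescoping step, as an exact matrix identity (any characteristic): the character cut for `insert j T` equals the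
character cut for `T` plus the coordinate cut `X_j` conjugated by the diagonal SIGN matrices of `T`. [folklore] -/
theorem characterCut_insert (row : ι → Fin n → Bool) (col : ι' → Fin n → Bool) (R : Matrix ι ι' K)
    (T : Finset (Fin n)) (j : Fin n) (hj : j ∉ T) :
    (Matrix.of fun x y => if Odd ((insert j T).filter fun l => row x l ≠ col y l).card then R x y else 0) =
      (Matrix.of fun x y => if Odd (T.filter fun l => row x l ≠ col y l).card then R x y else 0) +
        Matrix.diagonal (fun x => ∏ l ∈ T, (if row x l then (-1 : K) else 1)) *
          (Matrix.of fun x y => if row x j ≠ col y j then R x y else 0) *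
          Matrix.diagonal (fun y => ∏ l ∈ T, (if col y l then (-1 : K) else 1)) := by
  classical
  ext x y
  simp only [Matrix.add_apply, Matrix.of_apply, Matrix.diagonal_mul, Matrix.mul_diagonal]
  have hsign : (∏ l ∈ T, (if row x l then (-1 : K) else 1)) * (∏ l ∈ T, (if col y l then (-1 : K) else 1)) =
      (-1) ^ (T.filter fun l => row x l ≠ col y l).card := prod_sign_mul_prod_sign T (row x) (col y)
  rw [Finset.filter_insert]
  by_cases h : row x j ≠ col y j
  · rw [if_pos h, if_pos h, Finset.card_insert_of_notMem (by simp [hj])]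
    have e : (∏ l ∈ T, if row x l = true then (-1 : K) else 1) * R x y *
        ∏ l ∈ T, (if col y l = true then (-1 : K) else 1) =
        (-1) ^ (T.filter fun l => row x l ≠ col y l).card * R x y := by
      rw [← hsign]; ring
    rw [e]
    rcases Nat.even_or_odd (T.filter fun l => row x l ≠ col y l).card with hev | hodd
    · rw [if_pos (hev.add_one), if_neg (Nat.not_odd_iff_even.mpr hev), hev.neg_one_pow]; ring
    · rw [if_neg (by rw [Nat.not_odd_iff_even]; exact hodd.add_one), if_pos hodd, hodd.neg_one_pow]; ring
  · rw [if_neg h, if_neg h, mul_zero, zero_mul, add_zero]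

/-- **Character cuts are cheap.** For every set `T` of coordinates, the part of `R` on colour pairs that differ at an ODD number of
coordinates of `T` (= pairs separated by the character `χ_T`) has rank at most the sum over `j ∈ T` of the coordinate-cut ranks.
Uniform in the field.  (Lead analysis of `stub_cutLemma`, rung (3).) [folklore] -/
theorem rank_characterCut_le (row : ι → Fin n → Bool) (col : ι' → Fin n → Bool) (R : Matrix ι ι' K) (T : Finset (Fin n)) :
    (Matrix.of fun x y => if Odd (T.filter fun l => row x l ≠ col y l).card then R x y else 0).rank ≤
      ∑ j ∈ T, (Matrix.of fun x y => if row x j ≠ col y j then R x y else 0).rank := by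
  classical
  induction T using Finset.induction_on with
  | empty =>
    have : (Matrix.of fun x y => if Odd ((∅ : Finset (Fin n)).filter fun l => row x l ≠ col y l).card
        then R x y else 0) = (0 : Matrix ι ι' K) := by
      ext x y; simp
    rw [this, Matrix.rank_zero, Finset.sum_empty]
  | insert j T hj ih =>
    rw [characterCut_insert row col R T j hj, Finset.sum_insert hj]
    have h1 := Literature.Computability.AlgebraicComplexity.rank_add_le
      (Matrix.of fun x y => if Odd (T.filter fun l => row x l ≠ col y l).card then R x y else 0)
      (Matrix.diagonal (fun x => ∏ l ∈ T, (if row x l then (-1 : K) else 1)) *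
          (Matrix.of fun x y => if row x j ≠ col y j then R x y else 0) *
          Matrix.diagonal (fun y => ∏ l ∈ T, (if col y l then (-1 : K) else 1)))
    have h2 : (Matrix.diagonal (fun x => ∏ l ∈ T, (if row x l then (-1 : K) else 1)) *
          (Matrix.of fun x y => if row x j ≠ col y j then R x y else 0) *
          Matrix.diagonal (fun y => ∏ l ∈ T, (if col y l then (-1 : K) else 1))).rank ≤
        (Matrix.of fun x y => if row x j ≠ col y j then R x y else 0).rank :=
      (Matrix.rank_mul_le_left _ _).trans (Matrix.rank_mul_le_right _ _)
    omega

/-- A submatrix never has larger rank (reindexing along arbitrary maps of finite types). [folklore] -/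
theorem rank_submatrix_le' {κ κ' : Type*} [Fintype κ] [Fintype κ'] [DecidableEq κ'] (A : Matrix ι ι' K)
    (f : κ → ι) (g : κ' → ι') : (A.submatrix f g).rank ≤ A.rank := by
  classical
  have h1 : A.submatrix f g = (Matrix.of fun (a : κ) (x : ι) => if x = f a then (1 : K) else 0) * A *
      (Matrix.of fun (y : ι') (b : κ') => if y = g b then (1 : K) else 0) := by
    ext a b
    simp [Matrix.mul_apply, Matrix.submatrix_apply, Finset.sum_ite_eq']
  rw [h1]
  exact (Matrix.rank_mul_le_left _ _).trans (Matrix.rank_mul_le_right _ _)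

/-- **Character-separated rectangles are cheap.** If every row colour indexed by `f` and every column colour indexed by `g`
differ at an ODD number of coordinates of `T` (equivalently: the row colours have one `χ_T`-parity and the column colours the
other — e.g. rows of even weight against columns of odd weight, `T = univ`), then the rectangle `R[f, g]` has rank at most
`∑_{j∈T} t_j`.  Any rectangle exhibiting a superpolynomial gap in the cut lemma must therefore NOT be separated by a character.
[folklore] -/
theorem rank_submatrix_characterSeparated_le {κ κ' : Type*} [Fintype κ] [Fintype κ'] [DecidableEq κ']
    (row : ι → Fin n → Bool) (col : ι' → Fin n → Bool) (R : Matrix ι ι' K) (T : Finset (Fin n))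
    (f : κ → ι) (g : κ' → ι')
    (hsep : ∀ a b, Odd (T.filter fun l => row (f a) l ≠ col (g b) l).card) :
    (R.submatrix f g).rank ≤ ∑ j ∈ T, (Matrix.of fun x y => if row x j ≠ col y j then R x y else 0).rank := by
  classical
  -- the rectangle is a submatrix of the character cut: on separated pairs the cut keeps the entry
  have hsub : R.submatrix f g =
      (Matrix.of fun x y => if Odd (T.filter fun l => row x l ≠ col y l).card then R x y else 0).submatrix f g := by
    ext a b
    simp only [Matrix.submatrix_apply, Matrix.of_apply]
    rw [if_pos (hsep a b)]
  rw [hsub]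
  exact (rank_submatrix_le' _ f g).trans (rank_characterCut_le row col R T)

end Summit.PneNP.PneNP.Theorems.CnfIdealGenLengthRankDefectRepresentationsCutLemmaCharacterCuts
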